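import Summits.ValiantsHypothesis.ValiantsHypothesis.Theorems.DefinabilityGapCrowdedFree
import Summits.ValiantsHypothesis.ValiantsHypothesis.Theorems.DefinabilityGapPivotPhaseA
import HarnessLib

/-!
# Definability gap, ROAD P: union bound for the crowded-line events (N1 v2 (c), Phase A)

Uniform constants for the light branch of `DefinabilityGapCrowdedFree`: with `2 ≤ s ≤ n₀`, on
every line with at least `n₀` light positions the sparse load is at most
`σ₀ = 4 p N s² / n₀` (`sparseLoad_le`), so each event "fewer than `B` free positions" weighs
at most `ε = exp(−e^{−2pN} s/8) + exp(−t²/(2(σ₀ + t/3)))`, and the union over the `#T · m`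
(curve, line) pairs weighs at most `#T · m · ε` (`weight_exists_fewFreeCols_le`,
`weight_exists_fewFreeRows_le`; pattern of `DefinabilityGapPivotGoodUnion`).  Lines with
fewer than `n₀` light positions are served by the heavy branch and need no event.
-/

namespace Summit.ValiantsHypothesis.ValiantsHypothesis.Theorems.DefinabilityGapCrowdedUnion

open Finset Real Literature.Probability.Moments
open Literature.Computability.AlgebraicComplexity Literature.Computability.MetaComplexity
open Summit.ValiantsHypothesis.ValiantsHypothesis.Theorems.DefinabilityGapAffineRung
open Summit.ValiantsHypothesis.ValiantsHypothesis.Theorems.DefinabilityGapPivotAdmissible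
open Summit.ValiantsHypothesis.ValiantsHypothesis.Theorems.DefinabilityGapPivotCrowded
open Summit.ValiantsHypothesis.ValiantsHypothesis.Theorems.DefinabilityGapPivotPhaseA
open Summit.ValiantsHypothesis.ValiantsHypothesis.Theorems.DefinabilityGapSparseFree
open Summit.ValiantsHypothesis.ValiantsHypothesis.Theorems.DefinabilityGapCrowdedFree

variable {m : ℕ}

/-- The uniform sparse load `σ₀ = 4 p N s² / n₀` dominates `sparseLoad p N n s` for
`2 ≤ s ≤ n₀ ≤ n`. [this file] -/
theorem sparseLoad_le_uniform {p : ℝ} (hp : 0 ≤ p) (N : ℕ) {s n₀ n : ℕ} (hs : 2 ≤ s)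
    (hsn : s ≤ n₀) (hn : n₀ ≤ n) :
    sparseLoad p N n s ≤ 4 * p * N * (s : ℝ) ^ 2 / n₀ := by
  have h1 := sparseLoad_le hp N hs (hsn.trans hn)
  have hn₀ : (0 : ℝ) < n₀ := by exact_mod_cast (show 0 < n₀ by omega)
  have hle : (n₀ : ℝ) ≤ n := by exact_mod_cast hn
  refine h1.trans (div_le_div_of_nonneg_left (by positivity) hn₀ hle)

open scoped Classical in
/-- **Row union bound for the crowded events.**  Point weights `≤ p ≤ 1/2`, `2 ≤ s ≤ n₀`,
`B ≤ e^{−2pN} s/2 − 2(σ₀ + t)` with `σ₀ = 4 p N s²/n₀`: the assignments for which some row of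
some curve of `T` with at least `n₀` light positions has fewer than `B` free columns weigh at
most `#T · m · (exp(−e^{−2pN} s/8) + exp(−t²/(2(σ₀ + t/3))))`. [this file] -/
theorem weight_exists_fewFreeCols_le {w : (Fin 3 → Fin (qOf m)) → Fin m → ℝ}
    (hw : ∀ b a, 0 ≤ w b a) (hw1 : ∀ b, ∑ a, w b a = 1) {p : ℝ} (hp0 : 0 < p)
    (hp : p ≤ 1 / 2) (hwp : ∀ b a, w b a ≤ p) (T : Finset (Fin 3 → Fin (qOf m))) {N : ℕ}
    (hN : 0 < N) {s n₀ : ℕ} (hs : 2 ≤ s) (hsn : s ≤ n₀) {t B : ℝ} (ht : 0 < t)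
    (hB : B ≤ exp (-(2 * p * N)) * s / 2 - 2 * (4 * p * N * (s : ℝ) ^ 2 / n₀ + t)) :
    ∑ r ∈ (Finset.univ : Finset ((Fin 3 → Fin (qOf m)) → Fin m)).filter
        (fun r => ∃ c ∈ T, ∃ i : Fin m, n₀ ≤ (lightCols T c N i).card ∧
          ((freeCols T c r i).card : ℝ) < B), prodWeight w r
      ≤ (T.card : ℝ) * m * (exp (-(exp (-(2 * p * N)) * s / 8)) +
          exp (-(t ^ 2 / (2 * (4 * p * N * (s : ℝ) ^ 2 / n₀ + 1 * t / 3))))) := by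
  set ε : ℝ := exp (-(exp (-(2 * p * N)) * s / 8)) +
    exp (-(t ^ 2 / (2 * (4 * p * N * (s : ℝ) ^ 2 / n₀ + 1 * t / 3)))) with hε
  set Bf : (Fin 3 → Fin (qOf m)) × Fin m → Finset ((Fin 3 → Fin (qOf m)) → Fin m) :=
    fun ci => Finset.univ.filter fun r => n₀ ≤ (lightCols T ci.1 N ci.2).card ∧
      ((freeCols T ci.1 r ci.2).card : ℝ) < B with hBf
  have hsub : (Finset.univ : Finset ((Fin 3 → Fin (qOf m)) → Fin m)).filter
      (fun r => ∃ c ∈ T, ∃ i : Fin m, n₀ ≤ (lightCols T c N i).card ∧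
        ((freeCols T c r i).card : ℝ) < B) ⊆
      (T ×ˢ (Finset.univ : Finset (Fin m))).biUnion Bf := by
    intro r hr
    obtain ⟨c, hc, i, hi⟩ := (Finset.mem_filter.mp hr).2
    exact Finset.mem_biUnion.mpr ⟨(c, i), Finset.mem_product.mpr ⟨hc, Finset.mem_univ _⟩,
      Finset.mem_filter.mpr ⟨Finset.mem_univ _, hi⟩⟩
  have hε0 : 0 ≤ ε := by positivity
  have h3 : ∀ ci ∈ T ×ˢ (Finset.univ : Finset (Fin m)), ∑ r ∈ Bf ci, prodWeight w r ≤ ε := by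
    intro ci _
    by_cases hlt : n₀ ≤ (lightCols T ci.1 N ci.2).card
    · have hmono : Bf ci ⊆ Finset.univ.filter
          fun r => ((freeCols T ci.1 r ci.2).card : ℝ) < B := by
        intro r hr
        exact Finset.mem_filter.mpr ⟨Finset.mem_univ _, (Finset.mem_filter.mp hr).2.2⟩
      refine le_trans (Finset.sum_le_sum_of_subset_of_nonneg hmono
        fun r _ _ => prodWeight_nonneg hw r) ?_
      exact weight_fewFreeCols_le hw hw1 hp0 hp hwp T ci.1 ci.2 hN hs (hsn.trans hlt) ht
        (sparseLoad_le_uniform hp0.le N hs hsn hlt) hB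
    · have hempty : Bf ci = ∅ := by
        refine Finset.filter_false_of_mem fun r _ h => hlt h.1
      rw [hempty, Finset.sum_empty]
      exact hε0
  calc _ ≤ ∑ r ∈ (T ×ˢ (Finset.univ : Finset (Fin m))).biUnion Bf, prodWeight w r :=
        Finset.sum_le_sum_of_subset_of_nonneg hsub fun r _ _ => prodWeight_nonneg hw r
    _ ≤ ∑ ci ∈ T ×ˢ (Finset.univ : Finset (Fin m)), ∑ r ∈ Bf ci, prodWeight w r :=
        weight_biUnion_le _ Bf hw
    _ ≤ ∑ ci ∈ T ×ˢ (Finset.univ : Finset (Fin m)), ε := Finset.sum_le_sum h3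
    _ = (T.card : ℝ) * m * ε := by
        rw [Finset.sum_const, Finset.card_product, Finset.card_univ, Fintype.card_fin,
          nsmul_eq_mul]
        push_cast
        ring

open scoped Classical in
/-- **Column union bound for the crowded events** (free rows of columns with at least `n₀`
light positions). [this file] -/
theorem weight_exists_fewFreeRows_le {w : (Fin 3 → Fin (qOf m)) → Fin m → ℝ}
    (hw : ∀ b a, 0 ≤ w b a) (hw1 : ∀ b, ∑ a, w b a = 1) {p : ℝ} (hp0 : 0 < p)
    (hp : p ≤ 1 / 2) (hwp : ∀ b a, w b a ≤ p) (T : Finset (Fin 3 → Fin (qOf m))) {N : ℕ}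
    (hN : 0 < N) {s n₀ : ℕ} (hs : 2 ≤ s) (hsn : s ≤ n₀) {t B : ℝ} (ht : 0 < t)
    (hB : B ≤ exp (-(2 * p * N)) * s / 2 - 2 * (4 * p * N * (s : ℝ) ^ 2 / n₀ + t)) :
    ∑ r ∈ (Finset.univ : Finset ((Fin 3 → Fin (qOf m)) → Fin m)).filter
        (fun r => ∃ c ∈ T, ∃ j : Fin m, n₀ ≤ (lightRows T c N j).card ∧
          ((freeRows T c r j).card : ℝ) < B), prodWeight w r
      ≤ (T.card : ℝ) * m * (exp (-(exp (-(2 * p * N)) * s / 8)) +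
          exp (-(t ^ 2 / (2 * (4 * p * N * (s : ℝ) ^ 2 / n₀ + 1 * t / 3))))) := by
  set ε : ℝ := exp (-(exp (-(2 * p * N)) * s / 8)) +
    exp (-(t ^ 2 / (2 * (4 * p * N * (s : ℝ) ^ 2 / n₀ + 1 * t / 3)))) with hε
  set Bf : (Fin 3 → Fin (qOf m)) × Fin m → Finset ((Fin 3 → Fin (qOf m)) → Fin m) :=
    fun cj => Finset.univ.filter fun r => n₀ ≤ (lightRows T cj.1 N cj.2).card ∧
      ((freeRows T cj.1 r cj.2).card : ℝ) < B with hBf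
  have hsub : (Finset.univ : Finset ((Fin 3 → Fin (qOf m)) → Fin m)).filter
      (fun r => ∃ c ∈ T, ∃ j : Fin m, n₀ ≤ (lightRows T c N j).card ∧
        ((freeRows T c r j).card : ℝ) < B) ⊆
      (T ×ˢ (Finset.univ : Finset (Fin m))).biUnion Bf := by
    intro r hr
    obtain ⟨c, hc, j, hj⟩ := (Finset.mem_filter.mp hr).2
    exact Finset.mem_biUnion.mpr ⟨(c, j), Finset.mem_product.mpr ⟨hc, Finset.mem_univ _⟩,
      Finset.mem_filter.mpr ⟨Finset.mem_univ _, hj⟩⟩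
  have hε0 : 0 ≤ ε := by positivity
  have h3 : ∀ cj ∈ T ×ˢ (Finset.univ : Finset (Fin m)), ∑ r ∈ Bf cj, prodWeight w r ≤ ε := by
    intro cj _
    by_cases hlt : n₀ ≤ (lightRows T cj.1 N cj.2).card
    · have hmono : Bf cj ⊆ Finset.univ.filter
          fun r => ((freeRows T cj.1 r cj.2).card : ℝ) < B := by
        intro r hr
        exact Finset.mem_filter.mpr ⟨Finset.mem_univ _, (Finset.mem_filter.mp hr).2.2⟩
      refine le_trans (Finset.sum_le_sum_of_subset_of_nonneg hmono
        fun r _ _ => prodWeight_nonneg hw r) ?_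
      exact weight_fewFreeRows_le hw hw1 hp0 hp hwp T cj.1 cj.2 hN hs (hsn.trans hlt) ht
        (sparseLoad_le_uniform hp0.le N hs hsn hlt) hB
    · have hempty : Bf cj = ∅ := by
        refine Finset.filter_false_of_mem fun r _ h => hlt h.1
      rw [hempty, Finset.sum_empty]
      exact hε0
  calc _ ≤ ∑ r ∈ (T ×ˢ (Finset.univ : Finset (Fin m))).biUnion Bf, prodWeight w r :=
        Finset.sum_le_sum_of_subset_of_nonneg hsub fun r _ _ => prodWeight_nonneg hw r
    _ ≤ ∑ cj ∈ T ×ˢ (Finset.univ : Finset (Fin m)), ∑ r ∈ Bf cj, prodWeight w r :=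
        weight_biUnion_le _ Bf hw
    _ ≤ ∑ cj ∈ T ×ˢ (Finset.univ : Finset (Fin m)), ε := Finset.sum_le_sum h3
    _ = (T.card : ℝ) * m * ε := by
        rw [Finset.sum_const, Finset.card_product, Finset.card_univ, Fintype.card_fin,
          nsmul_eq_mul]
        push_cast
        ring

end Summit.ValiantsHypothesis.ValiantsHypothesis.Theorems.DefinabilityGapCrowdedUnion
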